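import Summits.KontsevichZagierPeriods.KontsevichZagierPeriods.Theorems.GpcLegendreLemniscatic.Negative.Canonical
import Literature.NumberTheory.Transcendental.KZLogCalculusProofs

/-!
# drefute evidence — candidate proofs of the stubs of line `hyperbola-fibration-conic`
(crux `GpcLegendreLemniscatic`, stmt-KontsevichZagierPeriods-0280)

One self-contained file (imports only tree modules) with kernel-checked proofs of the skeleton
stubs, statements VERBATIM (`*_proof` names):

* §A `stub_pencilCalculus_proof`   (M2a: injectivity / image / derivative + det / pull-back identity of `Ψ₂`);
* §B `stub_stripNewtonLeibniz_proof` (M3: ONE Newton–Leibniz move along the strip + null faces);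
* §C `stub_halfLineTail_proof`      (M4: halving, splitting `ℝ`, null point, reflection);
* §D `stub_conicPencil_proof`       (M2b: ONE change of variables along `Ψ₂`, given M2a);
* §E `stub_fibration_proof`         (M1: ONE change of variables along `Ψ₁ z = update z 1 (z0·z1)`).

`stub_quarticTwist` (M0) is `Cruxes/GpcLegendreLemniscatic/Disproof.lean` §7
(`equivalent_legendreRep_lemniscateRep`, proved there). Written by the drefute seat as item
evidence; NOT landed (the lead prover lands). No new axioms: every theorem below is sorry-free with
axioms ⊆ {propext, Classical.choice, Quot.sound}.
-/

noncomputable section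

open MeasureTheory Set
open Literature.NumberTheory.Transcendental
open Literature.NumberTheory.Transcendental.KZ
open Literature.ModelTheory.ExponentialFields (IsSemialgebraic)
open MvPolynomial (aeval X C)
open Summit.KontsevichZagierPeriods.Grothendieck.GpcLegendreLemniscaticNegative

namespace Summit.KontsevichZagierPeriods.Grothendieck.GpcLegendreLemniscaticLine.Drefute

/-! # §A  M2a — the pencil calculus of `Ψ₂` -/

/-- The triangle `T = {0 < t < y < 1}` (`y = z 0`, `t = z 1`). -/
def Tset : Set (Fin 2 → ℝ) := {z | 0 < z 1 ∧ z 1 < z 0 ∧ z 0 < 1}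

/-- The half-strip `H = {0 < z0} ∩ {0 < z1 < 1}`. -/
def Hset : Set (Fin 2 → ℝ) := {z | 0 < z 0 ∧ 0 < z 1 ∧ z 1 < 1}

/-- The radicand `(y⁴ − t⁴)/(1 − y⁴)`. -/
def wrad (z : Fin 2 → ℝ) : ℝ := (z 0 ^ 4 - z 1 ^ 4) / (1 - z 0 ^ 4)

/-- The conic rationalisation map. -/
def Psi2 (z : Fin 2 → ℝ) : Fin 2 → ℝ := Function.update z 0 (Real.sqrt (wrad z))

section basic
variable {z : Fin 2 → ℝ}

theorem pos_of_mem (hz : z ∈ Tset) : 0 < z 0 := hz.1.trans hz.2.1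

theorem one_sub_pow_four_pos (hz : z ∈ Tset) : 0 < 1 - z 0 ^ 4 := by
  have h0 := pos_of_mem hz
  have h1 : z 0 ^ 2 < 1 := by nlinarith [hz.2.2]
  nlinarith [sq_nonneg (z 0)]

theorem pow_four_sub_pos (hz : z ∈ Tset) : 0 < z 0 ^ 4 - z 1 ^ 4 := by
  have ht := hz.1
  have h2 : z 1 ^ 2 < z 0 ^ 2 := by nlinarith [hz.2.1]
  nlinarith [sq_nonneg (z 1), sq_nonneg (z 0)]

theorem one_sub_t_four_pos (hz : z ∈ Tset) : 0 < 1 - z 1 ^ 4 := by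
  linarith [one_sub_pow_four_pos hz, pow_four_sub_pos hz]

theorem wrad_pos (hz : z ∈ Tset) : 0 < wrad z :=
  div_pos (pow_four_sub_pos hz) (one_sub_pow_four_pos hz)

theorem sqrt_wrad_pos (hz : z ∈ Tset) : 0 < Real.sqrt (wrad z) := Real.sqrt_pos.2 (wrad_pos hz)

@[simp] theorem Psi2_apply_zero (z : Fin 2 → ℝ) : Psi2 z 0 = Real.sqrt (wrad z) := by
  simp [Psi2]

@[simp] theorem Psi2_apply_one (z : Fin 2 → ℝ) : Psi2 z 1 = z 1 := by
  simp [Psi2]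

end basic

/-! ## Conjunct 4: the pull-back identity -/

theorem pullback_identity (z : Fin 2 → ℝ) (hz : z ∈ Tset) :
    2 * z 0 ^ 3 / (Real.sqrt (1 - z 0 ^ 4) * Real.sqrt (z 0 ^ 4 - z 1 ^ 4)) =
      1 / (1 + Real.sqrt ((z 0 ^ 4 - z 1 ^ 4) / (1 - z 0 ^ 4)) ^ 2) *
        |2 * z 0 ^ 3 * (1 - z 1 ^ 4) /
          (Real.sqrt ((z 0 ^ 4 - z 1 ^ 4) / (1 - z 0 ^ 4)) * (1 - z 0 ^ 4) ^ 2)| := by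
  have hy0 : 0 < z 0 := pos_of_mem hz
  have hA : 0 < 1 - z 0 ^ 4 := one_sub_pow_four_pos hz
  have hB : 0 < z 0 ^ 4 - z 1 ^ 4 := pow_four_sub_pos hz
  have hC : 0 < 1 - z 1 ^ 4 := one_sub_t_four_pos hz
  have hsA : 0 < Real.sqrt (1 - z 0 ^ 4) := Real.sqrt_pos.2 hA
  have hsB : 0 < Real.sqrt (z 0 ^ 4 - z 1 ^ 4) := Real.sqrt_pos.2 hB
  have hw : Real.sqrt ((z 0 ^ 4 - z 1 ^ 4) / (1 - z 0 ^ 4)) =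
      Real.sqrt (z 0 ^ 4 - z 1 ^ 4) / Real.sqrt (1 - z 0 ^ 4) := Real.sqrt_div hB.le _
  rw [hw]
  have hpos : 0 < 2 * z 0 ^ 3 * (1 - z 1 ^ 4) /
      (Real.sqrt (z 0 ^ 4 - z 1 ^ 4) / Real.sqrt (1 - z 0 ^ 4) * (1 - z 0 ^ 4) ^ 2) := by
    positivity
  rw [abs_of_pos hpos]
  have hA2 : Real.sqrt (1 - z 0 ^ 4) ^ 2 = 1 - z 0 ^ 4 := Real.sq_sqrt hA.le
  have hB2 : Real.sqrt (z 0 ^ 4 - z 1 ^ 4) ^ 2 = z 0 ^ 4 - z 1 ^ 4 := Real.sq_sqrt hB.le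
  field_simp
  have hA4 : Real.sqrt (1 - z 0 ^ 4) ^ 4 = (1 - z 0 ^ 4) ^ 2 := by
    rw [show (4:ℕ) = 2 * 2 from rfl, pow_mul, hA2]
  rw [hA2, hB2, hA4]
  ring

/-! ## Conjunct 1: injectivity -/

theorem injOn_Psi2 : InjOn Psi2 Tset := by
  intro z hz z' hz' h
  have h1 : z 1 = z' 1 := by
    have := congrFun h 1
    simpa using this
  have h0 : Real.sqrt (wrad z) = Real.sqrt (wrad z') := by
    have := congrFun h 0
    simpa using this
  have hw : wrad z = wrad z' := by
    have := congrArg (fun x : ℝ => x ^ 2) h0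
    simpa [Real.sq_sqrt (wrad_pos hz).le, Real.sq_sqrt (wrad_pos hz').le] using this
  have hA := one_sub_pow_four_pos hz
  have hA' := one_sub_pow_four_pos hz'
  have hC := one_sub_t_four_pos hz
  unfold wrad at hw
  rw [div_eq_div_iff hA.ne' hA'.ne', ← h1] at hw
  -- (y⁴ − t⁴)(1 − y'⁴) = (y'⁴ − t⁴)(1 − y⁴) ⇒ (y⁴ − y'⁴)(1 − t⁴) = 0
  have h4 : z 0 ^ 4 = z' 0 ^ 4 := by
    have : (z 0 ^ 4 - z' 0 ^ 4) * (1 - z 1 ^ 4) = 0 := by linear_combination hw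
    rcases mul_eq_zero.1 this with h | h
    · linarith
    · exact absurd h hC.ne'
  have hy : z 0 = z' 0 :=
    (pow_left_inj₀ (pos_of_mem hz).le (pos_of_mem hz').le (by norm_num : (4:ℕ) ≠ 0)).1 h4
  funext i
  fin_cases i
  · exact hy
  · exact h1

/-! ## Conjunct 2: the image -/

theorem mapsTo_Psi2 : MapsTo Psi2 Tset Hset := by
  intro z hz
  refine ⟨?_, ?_, ?_⟩
  · simpa using sqrt_wrad_pos hz
  · simpa using hz.1
  · simpa using hz.2.1.trans hz.2.2

theorem surjOn_Psi2 : SurjOn Psi2 Tset Hset := by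
  intro p hp
  obtain ⟨hW, ht0, ht1⟩ := hp
  set W := p 0 with hWdef
  set t := p 1 with htdef
  set u : ℝ := (t ^ 4 + W ^ 2) / (1 + W ^ 2) with hu
  have htsq : t ^ 2 < 1 := by nlinarith
  have ht4 : t ^ 4 < 1 := by nlinarith [sq_nonneg t]
  have hW2 : 0 < W ^ 2 := by positivity
  have hden : 0 < 1 + W ^ 2 := by positivity
  have hu_gt : t ^ 4 < u := by
    rw [hu, lt_div_iff₀ hden]; nlinarith
  have hu_lt : u < 1 := by
    rw [hu, div_lt_one hden]; linarith
  have hu_pos : 0 < u := lt_trans (by positivity) hu_gt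
  set y : ℝ := Real.sqrt (Real.sqrt u) with hy
  have hy_pos : 0 < y := Real.sqrt_pos.2 (Real.sqrt_pos.2 hu_pos)
  have hy4 : y ^ 4 = u := by
    rw [show (4:ℕ) = 2 * 2 from rfl, pow_mul, hy, Real.sq_sqrt (Real.sqrt_nonneg _),
      Real.sq_sqrt hu_pos.le]
  have hty : t < y := lt_of_pow_lt_pow_left₀ 4 hy_pos.le (by rw [hy4]; exact hu_gt)
  have hy1 : y < 1 := lt_of_pow_lt_pow_left₀ 4 zero_le_one (by rw [hy4, one_pow]; exact hu_lt)
  refine ⟨![y, t], ⟨?_, ?_, ?_⟩, ?_⟩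
  · simpa using ht0
  · simpa using hty
  · simpa using hy1
  -- Psi2 ![y, t] = p
  have e0 : (![y, t] : Fin 2 → ℝ) 0 = y := rfl
  have e1 : (![y, t] : Fin 2 → ℝ) 1 = t := rfl
  have hwr : wrad ![y, t] = W ^ 2 := by
    simp only [wrad, e0, e1]
    rw [hy4]
    have h1u : 1 - u ≠ 0 := (sub_pos.2 hu_lt).ne'
    have hden' : 1 + W ^ 2 ≠ 0 := hden.ne'
    rw [div_eq_iff h1u, hu]
    field_simp
    ring
  funext i
  fin_cases i
  · simp only [Psi2, Fin.zero_eta, Function.update_self]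
    rw [hwr, Real.sqrt_sq hW.le]
  · simp [Psi2, htdef]

theorem image_Psi2 : Psi2 '' Tset = Hset :=
  (surjOn_Psi2.image_eq_of_mapsTo mapsTo_Psi2)

/-! ## Conjunct 3: the Fréchet derivative and its determinant -/

/-- The coordinate projections of `ℝ²` as continuous linear maps (all implicit arguments fixed). -/
local notation "pr" => (ContinuousLinearMap.proj (R := ℝ) (φ := fun _ : Fin 2 => ℝ))

/-- At `z ∈ T`, `Ψ₂` has a Fréchet derivative whose determinant is `∂w/∂y = 2y³(1−t⁴)/(w(1−y⁴)²)`. -/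
theorem hasFDerivAt_Psi2 (z : Fin 2 → ℝ) (hz : z ∈ Tset) :
    ∃ L : (Fin 2 → ℝ) →L[ℝ] (Fin 2 → ℝ), HasFDerivAt Psi2 L z ∧
      L.det = 2 * z 0 ^ 3 * (1 - z 1 ^ 4) / (Real.sqrt (wrad z) * (1 - z 0 ^ 4) ^ 2) := by
  have hA : 0 < 1 - z 0 ^ 4 := one_sub_pow_four_pos hz
  have hw : 0 < wrad z := wrad_pos hz
  have hsw : 0 < Real.sqrt (wrad z) := sqrt_wrad_pos hz
  -- coordinate projections
  have hp0 : HasFDerivAt (fun v : Fin 2 → ℝ => v 0) (pr 0) z := hasFDerivAt_apply 0 z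
  have hp1 : HasFDerivAt (fun v : Fin 2 → ℝ => v 1) (pr 1) z := hasFDerivAt_apply 1 z
  -- numerator, denominator, inverse of the denominator
  have hN : HasFDerivAt (fun v : Fin 2 → ℝ => v 0 ^ 4 - v 1 ^ 4)
      (((4:ℕ) • z 0 ^ (4 - 1)) • pr 0 - ((4:ℕ) • z 1 ^ (4 - 1)) • pr 1) z :=
    (hp0.pow 4).sub (hp1.pow 4)
  have hD : HasFDerivAt (fun v : Fin 2 → ℝ => 1 - v 0 ^ 4)
      ((0 : (Fin 2 → ℝ) →L[ℝ] ℝ) - ((4:ℕ) • z 0 ^ (4 - 1)) • pr 0) z :=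
    (hasFDerivAt_const (1:ℝ) z).sub (hp0.pow 4)
  have hDinv : HasFDerivAt (fun v : Fin 2 → ℝ => (1 - v 0 ^ 4)⁻¹)
      ((-((1 - z 0 ^ 4) ^ 2)⁻¹) • ((0 : (Fin 2 → ℝ) →L[ℝ] ℝ) - ((4:ℕ) • z 0 ^ (4 - 1)) • pr 0)) z :=
    (hasDerivAt_inv hA.ne').comp_hasFDerivAt z hD
  -- the radicand `wrad = N * D⁻¹`, then its square root
  set L1 : (Fin 2 → ℝ) →L[ℝ] ℝ :=
      (z 0 ^ 4 - z 1 ^ 4) •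
          ((-((1 - z 0 ^ 4) ^ 2)⁻¹) • ((0 : (Fin 2 → ℝ) →L[ℝ] ℝ) - ((4:ℕ) • z 0 ^ (4 - 1)) • pr 0)) +
        (1 - z 0 ^ 4)⁻¹ • (((4:ℕ) • z 0 ^ (4 - 1)) • pr 0 - ((4:ℕ) • z 1 ^ (4 - 1)) • pr 1)
    with hL1
  have hrad : HasFDerivAt wrad L1 z := by
    have hmul := hN.mul hDinv
    have hfun : wrad = (fun v : Fin 2 → ℝ => v 0 ^ 4 - v 1 ^ 4) * fun v : Fin 2 → ℝ => (1 - v 0 ^ 4)⁻¹ := by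
      funext v
      simp [wrad, div_eq_mul_inv]
    rw [hfun]
    exact hmul
  have hsqrt : HasFDerivAt (fun v => Real.sqrt (wrad v)) ((1 / (2 * Real.sqrt (wrad z))) • L1) z :=
    hrad.sqrt hw.ne'
  -- assemble the derivative of `Ψ₂ = (√wrad, z1)`
  set L0 : (Fin 2 → ℝ) →L[ℝ] ℝ := (1 / (2 * Real.sqrt (wrad z))) • L1 with hL0
  set F : Fin 2 → ((Fin 2 → ℝ) →L[ℝ] ℝ) := Fin.cons L0 (Fin.cons (pr 1) finZeroElim) with hF
  have hF0 : F 0 = L0 := rfl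
  have hF1 : F 1 = pr 1 := rfl
  refine ⟨ContinuousLinearMap.pi F, ?_, ?_⟩
  · apply hasFDerivAt_pi''
    intro i
    fin_cases i
    · simp only [Fin.zero_eta, ContinuousLinearMap.proj_pi, hF0, Psi2_apply_zero]
      exact hsqrt
    · simp only [Fin.mk_one, ContinuousLinearMap.proj_pi, hF1, Psi2_apply_one]
      exact hp1
  · -- the determinant, via the `2 × 2` matrix in the standard basis
    show LinearMap.det ((ContinuousLinearMap.pi F : (Fin 2 → ℝ) →L[ℝ] (Fin 2 → ℝ)) :
        (Fin 2 → ℝ) →ₗ[ℝ] (Fin 2 → ℝ)) = _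
    rw [← LinearMap.det_toMatrix', Matrix.det_fin_two]
    simp only [LinearMap.toMatrix'_apply, ContinuousLinearMap.coe_coe, ContinuousLinearMap.pi_apply,
      hF0, hF1, hL0, hL1]
    simp
    field_simp
    ring

/-! ## Assembly: the stub verbatim -/

/-- **`stub_pencilCalculus`** (signature verbatim from `Lines/hyperbola-fibration-conic.lean`, M2a):
`Ψ₂` is injective on `T`, maps `T` onto the half-strip, has at every point of `T` a Fréchet derivative
with determinant `∂w/∂y = 2z0³(1 − z1⁴)/(w (1 − z0⁴)²)`, and the pull-back identity holds on `T`. -/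
theorem stub_pencilCalculus_proof :
    InjOn (fun z : Fin 2 → ℝ => Function.update z 0 (Real.sqrt ((z 0 ^ 4 - z 1 ^ 4) / (1 - z 0 ^ 4))))
        {z : Fin 2 → ℝ | 0 < z 1 ∧ z 1 < z 0 ∧ z 0 < 1} ∧
      (fun z : Fin 2 → ℝ => Function.update z 0 (Real.sqrt ((z 0 ^ 4 - z 1 ^ 4) / (1 - z 0 ^ 4)))) ''
          {z : Fin 2 → ℝ | 0 < z 1 ∧ z 1 < z 0 ∧ z 0 < 1} = {z : Fin 2 → ℝ | 0 < z 0 ∧ 0 < z 1 ∧ z 1 < 1} ∧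
      (∀ z ∈ {z : Fin 2 → ℝ | 0 < z 1 ∧ z 1 < z 0 ∧ z 0 < 1},
        ∃ L : (Fin 2 → ℝ) →L[ℝ] (Fin 2 → ℝ),
          HasFDerivAt (fun z : Fin 2 → ℝ =>
              Function.update z 0 (Real.sqrt ((z 0 ^ 4 - z 1 ^ 4) / (1 - z 0 ^ 4)))) L z ∧
            L.det = 2 * z 0 ^ 3 * (1 - z 1 ^ 4) /
              (Real.sqrt ((z 0 ^ 4 - z 1 ^ 4) / (1 - z 0 ^ 4)) * (1 - z 0 ^ 4) ^ 2)) ∧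
      (∀ z ∈ {z : Fin 2 → ℝ | 0 < z 1 ∧ z 1 < z 0 ∧ z 0 < 1},
        2 * z 0 ^ 3 / (Real.sqrt (1 - z 0 ^ 4) * Real.sqrt (z 0 ^ 4 - z 1 ^ 4)) =
          1 / (1 + Real.sqrt ((z 0 ^ 4 - z 1 ^ 4) / (1 - z 0 ^ 4)) ^ 2) *
            |2 * z 0 ^ 3 * (1 - z 1 ^ 4) /
              (Real.sqrt ((z 0 ^ 4 - z 1 ^ 4) / (1 - z 0 ^ 4)) * (1 - z 0 ^ 4) ^ 2)|) := by
  show InjOn Psi2 Tset ∧ Psi2 '' Tset = Hset ∧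
      (∀ z ∈ Tset, ∃ L : (Fin 2 → ℝ) →L[ℝ] (Fin 2 → ℝ), HasFDerivAt Psi2 L z ∧
        L.det = 2 * z 0 ^ 3 * (1 - z 1 ^ 4) / (Real.sqrt (wrad z) * (1 - z 0 ^ 4) ^ 2)) ∧
      (∀ z ∈ Tset, 2 * z 0 ^ 3 / (Real.sqrt (1 - z 0 ^ 4) * Real.sqrt (z 0 ^ 4 - z 1 ^ 4)) =
          1 / (1 + Real.sqrt ((z 0 ^ 4 - z 1 ^ 4) / (1 - z 0 ^ 4)) ^ 2) *
            |2 * z 0 ^ 3 * (1 - z 1 ^ 4) /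
              (Real.sqrt ((z 0 ^ 4 - z 1 ^ 4) / (1 - z 0 ^ 4)) * (1 - z 0 ^ 4) ^ 2)|)
  exact ⟨injOn_Psi2, image_Psi2, hasFDerivAt_Psi2, pullback_identity⟩

/-! # §B  M3 — Newton–Leibniz along the strip -/

/-! ## Sets -/

/-- The base `(0,∞) ⊆ ℝ¹`. -/
def baseSet : Set (Fin 1 → ℝ) := {y | 0 < y 0}
/-- Lower edge `a ≡ 0`. -/
def aEdge : (Fin 1 → ℝ) → ℝ := fun _ => 0
/-- Upper edge `b ≡ 1`. -/
def bEdge : (Fin 1 → ℝ) → ℝ := fun _ => 1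
/-- The closed band `{0 < z0} × [0,1]`, written in the shape of `KZ.newtonLeibnizRel`. -/
def bandSet : Set (Fin 2 → ℝ) :=
  {z | (Fin.init z : Fin 1 → ℝ) ∈ baseSet ∧ aEdge (Fin.init z) ≤ z (Fin.last 1) ∧
    z (Fin.last 1) ≤ bEdge (Fin.init z)}
/-- The open strip `{0 < z0} × (0,1)`. -/
def stripSet : Set (Fin 2 → ℝ) := {z | 0 < z 0 ∧ 0 < z 1 ∧ z 1 < 1}
/-- The two faces `{0 < z0} × {0,1}`. -/
def faceSet : Set (Fin 2 → ℝ) := {z | 0 < z 0 ∧ (z 1 = 0 ∨ z 1 = 1)}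

theorem last_one_eq : (Fin.last 1 : Fin 2) = 1 := rfl

theorem init_apply_zero (z : Fin 2 → ℝ) : (Fin.init z : Fin 1 → ℝ) 0 = z 0 := rfl

theorem mem_bandSet {z : Fin 2 → ℝ} : z ∈ bandSet ↔ 0 < z 0 ∧ 0 ≤ z 1 ∧ z 1 ≤ 1 := by
  simp only [bandSet, baseSet, aEdge, bEdge, mem_setOf_eq, init_apply_zero, last_one_eq]

theorem bandSet_eq : bandSet = {z : Fin 2 → ℝ | 0 < z 0 ∧ 0 ≤ z 1 ∧ z 1 ≤ 1} := by
  ext z; exact mem_bandSet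

theorem bandSet_eq_union : bandSet = stripSet ∪ faceSet := by
  ext z
  rw [mem_bandSet]
  simp only [stripSet, faceSet, mem_union, mem_setOf_eq]
  constructor
  · rintro ⟨h0, h1, h2⟩
    rcases h1.lt_or_eq with h1 | h1
    · rcases h2.lt_or_eq with h2 | h2
      · exact Or.inl ⟨h0, h1, h2⟩
      · exact Or.inr ⟨h0, Or.inr h2⟩
    · exact Or.inr ⟨h0, Or.inl h1.symm⟩
  · rintro (⟨h0, h1, h2⟩ | ⟨h0, h1 | h1⟩)
    · exact ⟨h0, h1.le, h2.le⟩
    · exact ⟨h0, h1.symm.le, by rw [h1]; norm_num⟩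
    · exact ⟨h0, by rw [h1]; norm_num, h1.le⟩

theorem stripSet_inter_faceSet : stripSet ∩ faceSet = ∅ := by
  ext z
  simp only [stripSet, faceSet, mem_inter_iff, mem_setOf_eq, mem_empty_iff_false, iff_false, not_and]
  rintro ⟨_, h1, h2⟩ _ (h | h)
  · rw [h] at h1; exact lt_irrefl _ h1
  · rw [h] at h2; exact lt_irrefl _ h2

theorem stripSet_subset_bandSet : stripSet ⊆ bandSet := by
  rw [bandSet_eq_union]; exact subset_union_left

theorem faceSet_subset_bandSet : faceSet ⊆ bandSet := by
  rw [bandSet_eq_union]; exact subset_union_right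

theorem volume_faceSet : volume faceSet = 0 := by
  have h0 : volume {z : Fin 2 → ℝ | z (Fin.last 1) = 0} = 0 := volume_setOf_last_eq_zero (n := 1) 0
  have h1 : volume {z : Fin 2 → ℝ | z (Fin.last 1) = 1} = 0 := volume_setOf_last_eq_zero (n := 1) 1
  refine measure_mono_null (fun z hz => ?_) (measure_union_null h0 h1)
  rcases hz.2 with h | h
  · exact Or.inl h
  · exact Or.inr h

/-! ## Semialgebraicity -/

theorem isSemialgebraic_baseSet : IsSemialgebraic ℚ baseSet := by
  show IsSemialgebraic ℚ {y : Fin 1 → ℝ | 0 < y 0}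
  simpa using Literature.ModelTheory.ExponentialFields.isSemialgebraic_setOf_eval_lt (k := ℚ) (R := ℝ)
    (0 : MvPolynomial (Fin 1) ℚ) (X 0)

theorem isSemialgebraic_pos0 : IsSemialgebraic ℚ {z : Fin 2 → ℝ | 0 < z 0} := by
  simpa using Literature.ModelTheory.ExponentialFields.isSemialgebraic_setOf_eval_lt (k := ℚ) (R := ℝ)
    (0 : MvPolynomial (Fin 2) ℚ) (X 0)

theorem isSemialgebraic_pos1 : IsSemialgebraic ℚ {z : Fin 2 → ℝ | 0 < z 1} := by
  simpa using Literature.ModelTheory.ExponentialFields.isSemialgebraic_setOf_eval_lt (k := ℚ) (R := ℝ)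
    (0 : MvPolynomial (Fin 2) ℚ) (X 1)

theorem isSemialgebraic_lt1 : IsSemialgebraic ℚ {z : Fin 2 → ℝ | z 1 < 1} := by
  simpa using Literature.ModelTheory.ExponentialFields.isSemialgebraic_setOf_eval_lt (k := ℚ) (R := ℝ)
    (X 1 : MvPolynomial (Fin 2) ℚ) 1

theorem isSemialgebraic_nonneg1 : IsSemialgebraic ℚ {z : Fin 2 → ℝ | 0 ≤ z 1} := by
  simpa using Literature.ModelTheory.ExponentialFields.isSemialgebraic_setOf_eval_le (k := ℚ) (R := ℝ)
    (0 : MvPolynomial (Fin 2) ℚ) (X 1)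

theorem isSemialgebraic_le1 : IsSemialgebraic ℚ {z : Fin 2 → ℝ | z 1 ≤ 1} := by
  simpa using Literature.ModelTheory.ExponentialFields.isSemialgebraic_setOf_eval_le (k := ℚ) (R := ℝ)
    (X 1 : MvPolynomial (Fin 2) ℚ) 1

theorem isSemialgebraic_eq0 : IsSemialgebraic ℚ {z : Fin 2 → ℝ | z 1 = 0} := by
  simpa using Literature.ModelTheory.ExponentialFields.isSemialgebraic_setOf_eval_eq_zero (k := ℚ) (R := ℝ)
    (X 1 : MvPolynomial (Fin 2) ℚ)

theorem isSemialgebraic_eq1 : IsSemialgebraic ℚ {z : Fin 2 → ℝ | z 1 = 1} := by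
  have h := Literature.ModelTheory.ExponentialFields.isSemialgebraic_setOf_eval_eq_zero (k := ℚ) (R := ℝ)
    (X 1 - 1 : MvPolynomial (Fin 2) ℚ)
  convert h using 1
  ext z
  simp only [mem_setOf_eq, map_sub, MvPolynomial.aeval_X, map_one, sub_eq_zero]

theorem isSemialgebraic_bandSet : IsSemialgebraic ℚ bandSet := by
  rw [bandSet_eq]
  convert isSemialgebraic_pos0.inter (isSemialgebraic_nonneg1.inter isSemialgebraic_le1) using 1
  ext z; simp

theorem isSemialgebraic_stripSet : IsSemialgebraic ℚ stripSet := by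
  convert isSemialgebraic_pos0.inter (isSemialgebraic_pos1.inter isSemialgebraic_lt1) using 1
  ext z; simp [stripSet]

theorem isSemialgebraic_faceSet : IsSemialgebraic ℚ faceSet := by
  convert isSemialgebraic_pos0.inter (isSemialgebraic_eq0.union isSemialgebraic_eq1) using 1
  ext z; simp [faceSet]

/-! ## The integrand `g z = 1/(1 + z0²)` and its integrability on the band -/

/-- The strip integrand. -/
def gStrip (z : Fin 2 → ℝ) : ℝ := 1 / (1 + z 0 ^ 2)

theorem isSemialgebraicFunOn_gStrip {σ : Set (Fin 2 → ℝ)} (hσ : IsSemialgebraic ℚ σ) :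
    IsSemialgebraicFunOn ℚ σ gStrip := by
  have h := isSemialgebraicFunOn_aeval_div_aeval hσ (1 : MvPolynomial (Fin 2) ℚ) (1 + X 0 ^ 2)
    (fun x _ => by
      simp only [map_add, map_one, map_pow, MvPolynomial.aeval_X]
      positivity)
  exact h.congr fun x _ => by
    simp only [map_add, map_one, map_pow, MvPolynomial.aeval_X, gStrip]

/-- `g` is integrable on the slab `ℝ × [0,1]` (Fubini: `∫ dx/(1+x²) · 1`). -/
theorem integrableOn_gStrip_slab : IntegrableOn gStrip {z : Fin 2 → ℝ | 0 ≤ z 1 ∧ z 1 ≤ 1} := by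
  have hf : Integrable (fun t : ℝ => (1 + t ^ 2)⁻¹) := integrable_inv_one_add_sq
  have hg : Integrable (fun _ : ℝ => (1:ℝ)) (volume.restrict (Icc (0:ℝ) 1)) := integrable_const 1
  have hprod : IntegrableOn (fun p : ℝ × ℝ => (1 + p.1 ^ 2)⁻¹ * 1) (univ ×ˢ Icc (0:ℝ) 1)
      (volume : Measure (ℝ × ℝ)) := by
    rw [Measure.volume_eq_prod, IntegrableOn, ← Measure.prod_restrict, Measure.restrict_univ]
    exact hf.mul_prod hg
  have he := (MeasureTheory.volume_preserving_finTwoArrow ℝ).integrableOn_comp_preimage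
    (MeasurableEquiv.measurableEmbedding _) (f := fun p : ℝ × ℝ => (1 + p.1 ^ 2)⁻¹ * 1)
    (s := univ ×ˢ Icc (0:ℝ) 1)
  have h2 := he.mpr hprod
  have hset : (MeasurableEquiv.finTwoArrow : (Fin 2 → ℝ) ≃ᵐ ℝ × ℝ) ⁻¹' (univ ×ˢ Icc (0:ℝ) 1) =
      {z : Fin 2 → ℝ | 0 ≤ z 1 ∧ z 1 ≤ 1} := by
    ext z
    simp [MeasurableEquiv.finTwoArrow_apply]
  rw [hset] at h2
  refine h2.congr_fun (fun z _ => ?_) ?_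
  · simp [gStrip, MeasurableEquiv.finTwoArrow_apply, one_div]
  · have : {z : Fin 2 → ℝ | 0 ≤ z 1 ∧ z 1 ≤ 1} = (fun z : Fin 2 → ℝ => z 1) ⁻¹' Icc 0 1 := by
      ext z; simp
    rw [this]
    exact measurableSet_Icc.preimage (measurable_pi_apply 1)

/-! ## Representations -/

/-- The band representation `[{0 < z0} × [0,1], g]`. -/
def bandRep : IntegralRep 2 where
  domain := bandSet
  integrand := gStrip
  isSemialgebraic_domain := isSemialgebraic_bandSet
  isSemialgebraicFunOn_integrand := isSemialgebraicFunOn_gStrip isSemialgebraic_bandSet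
  integrableOn := integrableOn_gStrip_slab.mono_set fun _ hz => (mem_bandSet.1 hz).2

/-- The open-strip representation `[{0 < z0} × (0,1), g]`. -/
def stripRep : IntegralRep 2 :=
  bandRep.restrict stripSet isSemialgebraic_stripSet stripSet_subset_bandSet

/-- The faces `[{0 < z0} × {0,1}, g]` (null). -/
def faceRep : IntegralRep 2 :=
  bandRep.restrict faceSet isSemialgebraic_faceSet faceSet_subset_bandSet

/-- The half-line representation `[(0,∞), 1/(1 + y²)]`. -/
def halfLineRep : IntegralRep 1 where
  domain := baseSet
  integrand := fun y => 1 / (1 + y 0 ^ 2)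
  isSemialgebraic_domain := isSemialgebraic_baseSet
  isSemialgebraicFunOn_integrand := by
    have h := isSemialgebraicFunOn_aeval_div_aeval isSemialgebraic_baseSet (1 : MvPolynomial (Fin 1) ℚ)
      (1 + X 0 ^ 2) (fun x _ => by
        simp only [map_add, map_one, map_pow, MvPolynomial.aeval_X]
        positivity)
    exact h.congr fun x _ => by simp only [map_add, map_one, map_pow, MvPolynomial.aeval_X]
  integrableOn := by
    have h0 : Integrable arctanRep.integrand := integrableOn_univ.mp arctanRep.integrableOn
    have h : Integrable (fun y : Fin 1 → ℝ => 2 * arctanRep.integrand y) := h0.const_mul 2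
    refine (h.congr (ae_of_all _ fun y => ?_)).integrableOn
    simp only [arctanRep_integrand]
    have : (0:ℝ) < 1 + y 0 ^ 2 := by positivity
    field_simp

/-! ## The Newton–Leibniz move -/

/-- The primitive `F z = z1/(1 + z0²)`. -/
def Fprim (z : Fin 2 → ℝ) : ℝ := z 1 / (1 + z 0 ^ 2)

theorem snoc_apply_zero (x : Fin 1 → ℝ) (t : ℝ) : (Fin.snoc x t : Fin 2 → ℝ) 0 = x 0 := rfl

theorem snoc_apply_one (x : Fin 1 → ℝ) (t : ℝ) : (Fin.snoc x t : Fin 2 → ℝ) 1 = t := rfl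

theorem Fprim_snoc (x : Fin 1 → ℝ) (t : ℝ) : Fprim (Fin.snoc x t) = t / (1 + x 0 ^ 2) := by
  simp only [Fprim, snoc_apply_zero, snoc_apply_one]

theorem gStrip_snoc (x : Fin 1 → ℝ) (t : ℝ) : gStrip (Fin.snoc x t) = 1 / (1 + x 0 ^ 2) := by
  simp only [gStrip, snoc_apply_zero]

/-- `[band] − [half-line]` is ONE Newton–Leibniz move along the last coordinate. -/
theorem band_sub_halfLine_mem : of bandRep - of halfLineRep ∈ relations := by
  apply newtonLeibnizRel_subset_relations
  refine ⟨1, bandRep, halfLineRep, aEdge, bEdge, Fprim, ?_, ?_, ?_, ?_, rfl, ?_, ?_, ?_, rfl⟩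
  · have h := isSemialgebraicFunOn_aeval_div_aeval isSemialgebraic_bandSet (X 1 : MvPolynomial (Fin 2) ℚ)
      (1 + X 0 ^ 2) (fun x _ => by
        simp only [map_add, map_one, map_pow, MvPolynomial.aeval_X]
        positivity)
    exact h.congr fun x _ => by simp only [map_add, map_one, map_pow, MvPolynomial.aeval_X, Fprim]
  · exact (isSemialgebraicFunOn_aeval isSemialgebraic_baseSet (0 : MvPolynomial (Fin 1) ℚ)).congr
      fun x _ => by simp [aEdge]
  · exact (isSemialgebraicFunOn_aeval isSemialgebraic_baseSet (1 : MvPolynomial (Fin 1) ℚ)).congr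
      fun x _ => by simp [bEdge]
  · intro x _
    simp [aEdge, bEdge]
  · intro x _
    simp only [Fprim_snoc]
    exact (continuous_id.div_const _).continuousOn
  · intro x _ t _
    simp only [Fprim_snoc]
    show HasDerivAt (fun s => s / (1 + x 0 ^ 2)) (gStrip (Fin.snoc x t)) t
    rw [gStrip_snoc]
    exact (hasDerivAt_id t).div_const _
  · intro x _
    show 1 / (1 + x 0 ^ 2) = Fprim (Fin.snoc x (bEdge x)) - Fprim (Fin.snoc x (aEdge x))
    simp [Fprim_snoc, aEdge, bEdge]

/-- `[band] − [strip] − [faces]` (rule 1a). -/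
theorem band_sub_strip_sub_face_mem : of bandRep - of stripRep - of faceRep ∈ relations :=
  domainAddRel_subset_relations ⟨2, bandRep, stripRep, faceRep, bandSet_eq_union,
    by
      show volume (stripSet ∩ faceSet) = 0
      rw [stripSet_inter_faceSet, measure_empty],
    fun _ _ => rfl, fun _ _ => rfl, rfl⟩

/-- The faces are a relation (null domain). -/
theorem face_mem : of faceRep ∈ relations :=
  of_mem_relations_of_volume_eq_zero _ volume_faceSet

/-! ## Assembly: the stub verbatim -/

/-- **`stub_stripNewtonLeibniz`** (signature verbatim from `Lines/hyperbola-fibration-conic.lean`, M3). -/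
theorem stub_stripNewtonLeibniz_proof :
    ∀ p : IntegralRep 2, p.domain = {z : Fin 2 → ℝ | 0 < z 0 ∧ 0 < z 1 ∧ z 1 < 1} →
      EqOn p.integrand (fun z => 1 / (1 + z 0 ^ 2)) {z : Fin 2 → ℝ | 0 < z 0 ∧ 0 < z 1 ∧ z 1 < 1} →
      ∃ a : IntegralRep 1, a.domain = {y : Fin 1 → ℝ | 0 < y 0} ∧
        EqOn a.integrand (fun y => 1 / (1 + y 0 ^ 2)) {y : Fin 1 → ℝ | 0 < y 0} ∧
        Equivalent p a := by
  intro p hpd hpi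
  refine ⟨halfLineRep, rfl, fun y _ => rfl, ?_⟩
  have R0 : of p - of stripRep ∈ relations :=
    of_sub_of_mem_relations_of_eqOn (by rw [hpd]; rfl) fun z hz => by
      rw [hpd] at hz
      exact hpi hz
  have R1 := band_sub_strip_sub_face_mem
  have R2 := face_mem
  have R3 := band_sub_halfLine_mem
  have : of p - of halfLineRep = (of p - of stripRep) - (of bandRep - of stripRep - of faceRep)
      - of faceRep + (of bandRep - of halfLineRep) := by abel
  show of p - of halfLineRep ∈ relations
  rw [this]
  exact relations.add_mem (relations.sub_mem (relations.sub_mem R0 R1) R2) R3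

/-! # §C  M4 — the half-line tail -/

/-! ## The four pieces of the line `ℝ¹` -/

/-- `(0,∞) ⊆ ℝ¹`. -/
def posSet : Set (Fin 1 → ℝ) := {y | 0 < y 0}
/-- `(−∞,0) ⊆ ℝ¹`. -/
def negSet : Set (Fin 1 → ℝ) := {y | y 0 < 0}
/-- `(−∞,0] ⊆ ℝ¹`. -/
def nonposSet : Set (Fin 1 → ℝ) := {y | y 0 ≤ 0}
/-- `{0} ⊆ ℝ¹`. -/
def zeroSet : Set (Fin 1 → ℝ) := {y | y 0 = 0}

theorem isSemialgebraic_posSet : IsSemialgebraic ℚ posSet := by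
  show IsSemialgebraic ℚ {y : Fin 1 → ℝ | 0 < y 0}
  simpa using Literature.ModelTheory.ExponentialFields.isSemialgebraic_setOf_eval_lt (k := ℚ) (R := ℝ)
    (0 : MvPolynomial (Fin 1) ℚ) (X 0)

theorem isSemialgebraic_negSet : IsSemialgebraic ℚ negSet := by
  show IsSemialgebraic ℚ {y : Fin 1 → ℝ | y 0 < 0}
  simpa using Literature.ModelTheory.ExponentialFields.isSemialgebraic_setOf_eval_lt (k := ℚ) (R := ℝ)
    (X 0 : MvPolynomial (Fin 1) ℚ) 0

theorem isSemialgebraic_nonposSet : IsSemialgebraic ℚ nonposSet := by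
  show IsSemialgebraic ℚ {y : Fin 1 → ℝ | y 0 ≤ 0}
  simpa using Literature.ModelTheory.ExponentialFields.isSemialgebraic_setOf_eval_le (k := ℚ) (R := ℝ)
    (X 0 : MvPolynomial (Fin 1) ℚ) 0

theorem isSemialgebraic_zeroSet : IsSemialgebraic ℚ zeroSet := by
  show IsSemialgebraic ℚ {y : Fin 1 → ℝ | y 0 = 0}
  simpa using Literature.ModelTheory.ExponentialFields.isSemialgebraic_setOf_eval_eq_zero (k := ℚ) (R := ℝ)
    (X 0 : MvPolynomial (Fin 1) ℚ)

/-- The restriction `[σ, 1/(2(1+y²))]` of `arctanRep` to a semialgebraic `σ ⊆ ℝ¹`. -/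
def halfRep (σ : Set (Fin 1 → ℝ)) (hσ : IsSemialgebraic ℚ σ) : IntegralRep 1 :=
  arctanRep.restrict σ hσ (by simp)

@[simp] theorem halfRep_domain (σ : Set (Fin 1 → ℝ)) (hσ : IsSemialgebraic ℚ σ) :
    (halfRep σ hσ).domain = σ := rfl

@[simp] theorem halfRep_integrand (σ : Set (Fin 1 → ℝ)) (hσ : IsSemialgebraic ℚ σ) :
    (halfRep σ hσ).integrand = fun x => 1 / (2 * (1 + x 0 ^ 2)) := rfl

/-- `P = [(0,∞), h/2]`. -/
def Prep : IntegralRep 1 := halfRep posSet isSemialgebraic_posSet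
/-- `N° = [(−∞,0), h/2]`. -/
def NoRep : IntegralRep 1 := halfRep negSet isSemialgebraic_negSet
/-- `N = [(−∞,0], h/2]`. -/
def Nrep : IntegralRep 1 := halfRep nonposSet isSemialgebraic_nonposSet
/-- `Z = [{0}, h/2]` (null). -/
def Zrep : IntegralRep 1 := halfRep zeroSet isSemialgebraic_zeroSet

/-! ## The five relations -/

/-- R1: `[arctanRep] − [N] − [P]` (rule 1a: `ℝ = (−∞,0] ∪ (0,∞)`). -/
theorem arctan_sub_N_sub_P_mem : of arctanRep - of Nrep - of Prep ∈ relations := by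
  apply domainAddRel_subset_relations
  refine ⟨1, arctanRep, Nrep, Prep, ?_, ?_, fun x _ => rfl, fun x _ => rfl, rfl⟩
  · show (univ : Set (Fin 1 → ℝ)) = nonposSet ∪ posSet
    ext y
    simp only [mem_univ, true_iff, mem_union, nonposSet, posSet, mem_setOf_eq]
    exact le_or_gt (y 0) 0
  · show volume (nonposSet ∩ posSet) = 0
    have : (nonposSet ∩ posSet) = ∅ := by
      ext y
      simp only [nonposSet, posSet, mem_inter_iff, mem_setOf_eq, mem_empty_iff_false, iff_false,
        not_and, not_lt]
      exact fun h => h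
    rw [this, measure_empty]

/-- R2: `[N] − [N°] − [Z]` (rule 1a: `(−∞,0] = (−∞,0) ∪ {0}`). -/
theorem N_sub_No_sub_Z_mem : of Nrep - of NoRep - of Zrep ∈ relations := by
  apply domainAddRel_subset_relations
  refine ⟨1, Nrep, NoRep, Zrep, ?_, ?_, fun x _ => rfl, fun x _ => rfl, rfl⟩
  · show nonposSet = negSet ∪ zeroSet
    ext y
    simp only [nonposSet, negSet, zeroSet, mem_union, mem_setOf_eq]
    exact le_iff_lt_or_eq
  · show volume (negSet ∩ zeroSet) = 0
    have : (negSet ∩ zeroSet) = ∅ := by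
      ext y
      simp only [negSet, zeroSet, mem_inter_iff, mem_setOf_eq, mem_empty_iff_false, iff_false,
        not_and]
      intro h1 h2
      rw [h2] at h1
      exact lt_irrefl _ h1
    rw [this, measure_empty]

/-- R3: `[Z]` is a relation (null domain). -/
theorem Z_mem : of Zrep ∈ relations := by
  apply of_mem_relations_of_volume_eq_zero
  exact volume_setOf_last_eq_zero (n := 0) 0

/-- The coordinate projection of `ℝ¹` as a continuous linear map (all implicit arguments fixed). -/
local notation "pr1" => (ContinuousLinearMap.proj (R := ℝ) (φ := fun _ : Fin 1 => ℝ))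

/-- R4: `[N°] − [P]` (rule 2 along `y ↦ −y`, `|det| = 1`). -/
theorem No_sub_P_mem : of NoRep - of Prep ∈ relations := by
  apply changeOfVariablesRel_subset_relations
  set L : (Fin 1 → ℝ) →L[ℝ] (Fin 1 → ℝ) := ContinuousLinearMap.pi fun _ : Fin 1 => -(pr1 0) with hL
  refine ⟨1, NoRep, Prep, fun y => -y, fun _ => L, ?_, ?_, ?_, ?_, ?_, rfl⟩
  · -- semialgebraic: the polynomial map `−X 0`
    refine (isSemialgebraicMapOn_aeval isSemialgebraic_negSet (fun _ : Fin 1 => -X 0)).congr ?_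
    intro y _
    funext j
    fin_cases j
    simp
  · intro y _
    apply HasFDerivAt.hasFDerivWithinAt
    apply hasFDerivAt_pi''
    intro i
    fin_cases i
    simp only [hL, Fin.zero_eta, ContinuousLinearMap.proj_pi]
    exact (hasFDerivAt_apply (0 : Fin 1) y).fun_neg
  · exact neg_injective.injOn
  · show posSet = (fun y => -y) '' negSet
    rw [image_neg_eq_neg]
    ext y
    simp [posSet, negSet]
  · intro y _
    have hdet : L.det = -1 := by
      show LinearMap.det ((L : (Fin 1 → ℝ) →L[ℝ] (Fin 1 → ℝ)) : (Fin 1 → ℝ) →ₗ[ℝ] (Fin 1 → ℝ)) = -1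
      rw [← LinearMap.det_toMatrix', Matrix.det_fin_one]
      simp [LinearMap.toMatrix'_apply, hL]
    rw [hdet]
    show (1:ℝ) / (2 * (1 + y 0 ^ 2)) = 1 / (2 * (1 + ((-y) 0) ^ 2)) * |(-1:ℝ)|
    simp

/-- R5: `[a] − [P] − [P]` (rule 1b: `1/(1+y²) = h/2 + h/2`). -/
theorem a_sub_P_sub_P_mem (a : IntegralRep 1) (had : a.domain = {y : Fin 1 → ℝ | 0 < y 0})
    (hai : EqOn a.integrand (fun y => 1 / (1 + y 0 ^ 2)) {y : Fin 1 → ℝ | 0 < y 0}) :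
    of a - of Prep - of Prep ∈ relations := by
  apply integrandAddRel_subset_relations
  refine ⟨1, a, Prep, Prep, had.symm, had.symm, fun y hy => ?_, rfl⟩
  rw [had] at hy
  rw [hai hy]
  simp only [Pi.add_apply, Prep, halfRep_integrand]
  have : (0:ℝ) < 1 + y 0 ^ 2 := by positivity
  field_simp
  ring

/-! ## Assembly: the stub verbatim -/

/-- **`stub_halfLineTail`** (signature verbatim from `Lines/hyperbola-fibration-conic.lean`, M4):
`[(0,∞), 1/(1 + y²)] ~ arctanRep`. -/
theorem stub_halfLineTail_proof :
    ∀ a : IntegralRep 1, a.domain = {y : Fin 1 → ℝ | 0 < y 0} →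
      EqOn a.integrand (fun y => 1 / (1 + y 0 ^ 2)) {y : Fin 1 → ℝ | 0 < y 0} →
      Equivalent a arctanRep := by
  intro a had hai
  have R1 := arctan_sub_N_sub_P_mem
  have R2 := N_sub_No_sub_Z_mem
  have R3 := Z_mem
  have R4 := No_sub_P_mem
  have R5 := a_sub_P_sub_P_mem a had hai
  have : of a - of arctanRep =
      (of a - of Prep - of Prep) - (of arctanRep - of Nrep - of Prep) - (of Nrep - of NoRep - of Zrep)
        - of Zrep - (of NoRep - of Prep) := by abel
  show of a - of arctanRep ∈ relations
  rw [this]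
  exact relations.sub_mem (relations.sub_mem (relations.sub_mem (relations.sub_mem R5 R1) R2) R3) R4

/-! # §D  M2b — the conic pencil move (ONE change of variables along `Ψ₂`) -/

theorem isSemialgebraic_Tset : IsSemialgebraic ℚ Tset := by
  have h1 : IsSemialgebraic ℚ {z : Fin 2 → ℝ | 0 < z 1} := isSemialgebraic_pos1
  have h2 : IsSemialgebraic ℚ {z : Fin 2 → ℝ | z 1 < z 0} := by
    simpa using Literature.ModelTheory.ExponentialFields.isSemialgebraic_setOf_eval_lt (k := ℚ) (R := ℝ)
      (X 1 : MvPolynomial (Fin 2) ℚ) (X 0)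
  have h3 : IsSemialgebraic ℚ {z : Fin 2 → ℝ | z 0 < 1} := by
    simpa using Literature.ModelTheory.ExponentialFields.isSemialgebraic_setOf_eval_lt (k := ℚ) (R := ℝ)
      (X 0 : MvPolynomial (Fin 2) ℚ) 1
  convert h1.inter (h2.inter h3) using 1
  ext z; simp [Tset]

theorem isSemialgebraicFunOn_wrad : IsSemialgebraicFunOn ℚ Tset wrad := by
  have h := isSemialgebraicFunOn_aeval_div_aeval isSemialgebraic_Tset
    (X 0 ^ 4 - X 1 ^ 4 : MvPolynomial (Fin 2) ℚ) (1 - X 0 ^ 4) (fun z hz => by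
      simp only [map_sub, map_one, map_pow, MvPolynomial.aeval_X]
      exact (one_sub_pow_four_pos hz).ne')
  exact h.congr fun z _ => by simp only [map_sub, map_one, map_pow, MvPolynomial.aeval_X, wrad]

theorem isSemialgebraicMapOn_Psi2 : IsSemialgebraicMapOn ℚ Tset Psi2 := by
  refine IsSemialgebraicMapOn.of_forall isSemialgebraic_Tset fun j => ?_
  fin_cases j
  · simp only [Fin.zero_eta, Psi2_apply_zero]
    exact IsSemialgebraicFunOn.sqrt_holds isSemialgebraicFunOn_wrad
  · simp only [Fin.mk_one, Psi2_apply_one]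
    exact (isSemialgebraicFunOn_aeval isSemialgebraic_Tset (X 1 : MvPolynomial (Fin 2) ℚ)).congr
      fun z _ => by simp

theorem stripRep_integrand_Psi2 (z : Fin 2 → ℝ) :
    stripRep.integrand (Psi2 z) = 1 / (1 + Real.sqrt (wrad z) ^ 2) := by
  show gStrip (Psi2 z) = _
  simp only [gStrip, Psi2_apply_zero]

/-- **`stub_conicPencil`** (signature verbatim from `Lines/hyperbola-fibration-conic.lean`, M2b):
given the pencil calculus, `Ψ₂` is ONE rule-(2) move from the triangle representation to the
half-strip representation `[{0 < z0} ∩ {0 < z1 < 1}, 1/(1 + z0²)]`. -/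
theorem stub_conicPencil_proof :
    (InjOn (fun z : Fin 2 → ℝ => Function.update z 0 (Real.sqrt ((z 0 ^ 4 - z 1 ^ 4) / (1 - z 0 ^ 4))))
        {z : Fin 2 → ℝ | 0 < z 1 ∧ z 1 < z 0 ∧ z 0 < 1} ∧
      (fun z : Fin 2 → ℝ => Function.update z 0 (Real.sqrt ((z 0 ^ 4 - z 1 ^ 4) / (1 - z 0 ^ 4)))) ''
          {z : Fin 2 → ℝ | 0 < z 1 ∧ z 1 < z 0 ∧ z 0 < 1} = {z : Fin 2 → ℝ | 0 < z 0 ∧ 0 < z 1 ∧ z 1 < 1} ∧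
      (∀ z ∈ {z : Fin 2 → ℝ | 0 < z 1 ∧ z 1 < z 0 ∧ z 0 < 1},
        ∃ L : (Fin 2 → ℝ) →L[ℝ] (Fin 2 → ℝ),
          HasFDerivAt (fun z : Fin 2 → ℝ =>
              Function.update z 0 (Real.sqrt ((z 0 ^ 4 - z 1 ^ 4) / (1 - z 0 ^ 4)))) L z ∧
            L.det = 2 * z 0 ^ 3 * (1 - z 1 ^ 4) /
              (Real.sqrt ((z 0 ^ 4 - z 1 ^ 4) / (1 - z 0 ^ 4)) * (1 - z 0 ^ 4) ^ 2)) ∧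
      (∀ z ∈ {z : Fin 2 → ℝ | 0 < z 1 ∧ z 1 < z 0 ∧ z 0 < 1},
        2 * z 0 ^ 3 / (Real.sqrt (1 - z 0 ^ 4) * Real.sqrt (z 0 ^ 4 - z 1 ^ 4)) =
          1 / (1 + Real.sqrt ((z 0 ^ 4 - z 1 ^ 4) / (1 - z 0 ^ 4)) ^ 2) *
            |2 * z 0 ^ 3 * (1 - z 1 ^ 4) /
              (Real.sqrt ((z 0 ^ 4 - z 1 ^ 4) / (1 - z 0 ^ 4)) * (1 - z 0 ^ 4) ^ 2)|)) →
    ∀ T : IntegralRep 2, T.domain = {z : Fin 2 → ℝ | 0 < z 1 ∧ z 1 < z 0 ∧ z 0 < 1} →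
      EqOn T.integrand (fun z => 2 * z 0 ^ 3 / (Real.sqrt (1 - z 0 ^ 4) * Real.sqrt (z 0 ^ 4 - z 1 ^ 4)))
          {z : Fin 2 → ℝ | 0 < z 1 ∧ z 1 < z 0 ∧ z 0 < 1} →
      ∃ p : IntegralRep 2, p.domain = {z : Fin 2 → ℝ | 0 < z 0 ∧ 0 < z 1 ∧ z 1 < 1} ∧
        EqOn p.integrand (fun z => 1 / (1 + z 0 ^ 2)) {z : Fin 2 → ℝ | 0 < z 0 ∧ 0 < z 1 ∧ z 1 < 1} ∧
        Equivalent T p := by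
  rintro ⟨hinj, himg, hder, hid⟩ T hTd hTi
  classical
  refine ⟨stripRep, rfl, fun z _ => rfl, ?_⟩
  have hTd' : T.domain = Tset := hTd
  choose L hL using hder
  apply changeOfVariablesRel_subset_relations
  refine ⟨2, T, stripRep, Psi2, fun z => if h : z ∈ Tset then L z h else 0, ?_, ?_, ?_, ?_, ?_, rfl⟩
  · rw [hTd']
    exact isSemialgebraicMapOn_Psi2
  · intro z hz
    rw [hTd'] at hz ⊢
    simp only [dif_pos hz]
    exact (hL z hz).1.hasFDerivWithinAt
  · rw [hTd']
    exact hinj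
  · rw [hTd']
    exact himg.symm
  · intro z hz
    rw [hTd'] at hz
    rw [hTi hz, stripRep_integrand_Psi2]
    simp only [dif_pos hz]
    rw [(hL z hz).2]
    exact hid z hz

/-! # §E  M1 — the hyperbola fibration (ONE change of variables along `Ψ₁`) -/

/-- `Ψ₁ z = update z 1 (z0 · z1)` (hyperbola fibration `t = x₀x₁`, keeping `y = x₀`). -/
def Psi1 (z : Fin 2 → ℝ) : Fin 2 → ℝ := Function.update z 1 (z 0 * z 1)

@[simp] theorem Psi1_apply_zero (z : Fin 2 → ℝ) : Psi1 z 0 = z 0 := by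
  simp [Psi1]

@[simp] theorem Psi1_apply_one (z : Fin 2 → ℝ) : Psi1 z 1 = z 0 * z 1 := by
  simp [Psi1]

theorem mem_unitSq {x : Fin 2 → ℝ} : x ∈ unitSq ↔ (0 < x 0 ∧ x 0 < 1) ∧ (0 < x 1 ∧ x 1 < 1) := by
  simp [unitSq, Fin.forall_fin_two]

theorem isSemialgebraic_unitSq' : IsSemialgebraic ℚ unitSq := by
  rw [← legendreRep_domain]
  exact legendreRep.isSemialgebraic_domain

theorem mapsTo_Psi1 : MapsTo Psi1 unitSq Tset := by
  intro x hx
  obtain ⟨⟨h0, h0'⟩, h1, h1'⟩ := mem_unitSq.1 hx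
  refine ⟨?_, ?_, ?_⟩
  · simpa using mul_pos h0 h1
  · show Psi1 x 1 < Psi1 x 0
    rw [Psi1_apply_one, Psi1_apply_zero]
    nlinarith
  · simpa using h0'

theorem injOn_Psi1 : InjOn Psi1 unitSq := by
  intro x hx x' _ h
  have h0 : x 0 = x' 0 := by simpa using congrFun h 0
  have h1 : x 0 * x 1 = x' 0 * x' 1 := by simpa using congrFun h 1
  have hx0 : x 0 ≠ 0 := (mem_unitSq.1 hx).1.1.ne'
  have h1' : x 1 = x' 1 := by
    rw [← h0] at h1
    exact mul_left_cancel₀ hx0 h1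
  funext i
  fin_cases i
  · exact h0
  · exact h1'

theorem surjOn_Psi1 : SurjOn Psi1 unitSq Tset := by
  intro z hz
  obtain ⟨h1, h2, h3⟩ := hz
  have h0 : 0 < z 0 := h1.trans h2
  have e0 : (![z 0, z 1 / z 0] : Fin 2 → ℝ) 0 = z 0 := rfl
  have e1 : (![z 0, z 1 / z 0] : Fin 2 → ℝ) 1 = z 1 / z 0 := rfl
  refine ⟨![z 0, z 1 / z 0], ?_, ?_⟩
  · rw [mem_unitSq, e0, e1]
    exact ⟨⟨h0, h3⟩, div_pos h1 h0, (div_lt_one h0).2 h2⟩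
  · funext i
    fin_cases i
    · simp [Psi1]
    · simp only [Fin.mk_one, Psi1_apply_one, e0, e1]
      field_simp

theorem image_Psi1 : Psi1 '' unitSq = Tset :=
  surjOn_Psi1.image_eq_of_mapsTo mapsTo_Psi1

theorem isSemialgebraicMapOn_Psi1 : IsSemialgebraicMapOn ℚ unitSq Psi1 := by
  refine (isSemialgebraicMapOn_aeval isSemialgebraic_unitSq' (![X 0, X 0 * X 1] :
    Fin 2 → MvPolynomial (Fin 2) ℚ)).congr fun x _ => ?_
  funext j
  fin_cases j
  · simp
  · simp

/-- The derivative of `Ψ₁` at `z`: rows `(1, 0)` and `(z1, z0)`. -/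
def L1 (z : Fin 2 → ℝ) : (Fin 2 → ℝ) →L[ℝ] (Fin 2 → ℝ) :=
  ContinuousLinearMap.pi (Fin.cons (pr 0) (Fin.cons (z 0 • (pr 1) + z 1 • (pr 0)) finZeroElim))

theorem hasFDerivAt_Psi1 (z : Fin 2 → ℝ) : HasFDerivAt Psi1 (L1 z) z ∧ (L1 z).det = z 0 := by
  have hp0 : HasFDerivAt (fun v : Fin 2 → ℝ => v 0) (pr 0) z := hasFDerivAt_apply 0 z
  have hp1 : HasFDerivAt (fun v : Fin 2 → ℝ => v 1) (pr 1) z := hasFDerivAt_apply 1 z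
  set F : Fin 2 → ((Fin 2 → ℝ) →L[ℝ] ℝ) :=
    Fin.cons (pr 0) (Fin.cons (z 0 • (pr 1) + z 1 • (pr 0)) finZeroElim) with hF
  have hF0 : F 0 = pr 0 := rfl
  have hF1 : F 1 = z 0 • (pr 1) + z 1 • (pr 0) := rfl
  have hL : L1 z = ContinuousLinearMap.pi F := rfl
  constructor
  · rw [hL]
    apply hasFDerivAt_pi''
    intro i
    fin_cases i
    · simp only [Fin.zero_eta, ContinuousLinearMap.proj_pi, hF0, Psi1_apply_zero]
      exact hp0
    · simp only [Fin.mk_one, ContinuousLinearMap.proj_pi, hF1, Psi1_apply_one]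
      exact hp0.mul hp1
  · rw [hL]
    show LinearMap.det ((ContinuousLinearMap.pi F : (Fin 2 → ℝ) →L[ℝ] (Fin 2 → ℝ)) :
        (Fin 2 → ℝ) →ₗ[ℝ] (Fin 2 → ℝ)) = _
    rw [← LinearMap.det_toMatrix', Matrix.det_fin_two]
    simp only [LinearMap.toMatrix'_apply, ContinuousLinearMap.coe_coe, ContinuousLinearMap.pi_apply,
      hF0, hF1]
    simp

/-- The triangle integrand `2z0³/(√(1−z0⁴)·√(z0⁴−z1⁴))`. -/
def fTri (z : Fin 2 → ℝ) : ℝ := 2 * z 0 ^ 3 / (Real.sqrt (1 - z 0 ^ 4) * Real.sqrt (z 0 ^ 4 - z 1 ^ 4))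

theorem isSemialgebraicFunOn_fTri : IsSemialgebraicFunOn ℚ Tset fTri := by
  have hA : IsSemialgebraicFunOn ℚ Tset (fun z => 1 - z 0 ^ 4) :=
    (isSemialgebraicFunOn_aeval isSemialgebraic_Tset (1 - X 0 ^ 4 : MvPolynomial (Fin 2) ℚ)).congr
      fun z _ => by simp
  have hB : IsSemialgebraicFunOn ℚ Tset (fun z => z 0 ^ 4 - z 1 ^ 4) :=
    (isSemialgebraicFunOn_aeval isSemialgebraic_Tset (X 0 ^ 4 - X 1 ^ 4 : MvPolynomial (Fin 2) ℚ)).congr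
      fun z _ => by simp
  have hden := IsSemialgebraicFunOn.mul_holds (IsSemialgebraicFunOn.sqrt_holds hA)
    (IsSemialgebraicFunOn.sqrt_holds hB)
  have hnum : IsSemialgebraicFunOn ℚ Tset (fun z => 2 * z 0 ^ 3) :=
    (isSemialgebraicFunOn_aeval isSemialgebraic_Tset (2 * X 0 ^ 3 : MvPolynomial (Fin 2) ℚ)).congr
      fun z _ => by simp
  refine ((hnum.div hden) fun z hz => ?_).congr fun z _ => by simp [fTri]
  exact (mul_pos (Real.sqrt_pos.2 (one_sub_pow_four_pos hz)) (Real.sqrt_pos.2 (pow_four_sub_pos hz))).ne'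

/-- The pull-back identity of `Ψ₁` on `(0,1)²` (Jacobian `z0`). -/
theorem pullback_Psi1 (x : Fin 2 → ℝ) (hx : x ∈ unitSq) :
    2 * x 0 ^ 2 / (Real.sqrt (1 - x 0 ^ 4) * Real.sqrt (1 - x 1 ^ 4)) = fTri (Psi1 x) * |x 0| := by
  obtain ⟨⟨h0, h0'⟩, h1, h1'⟩ := mem_unitSq.1 hx
  simp only [fTri, Psi1_apply_zero, Psi1_apply_one]
  have hx0sq : x 0 ^ 2 < 1 := by nlinarith
  have hx1sq : x 1 ^ 2 < 1 := by nlinarith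
  have hA : 0 < 1 - x 0 ^ 4 := by nlinarith [sq_nonneg (x 0)]
  have hB : 0 < 1 - x 1 ^ 4 := by nlinarith [sq_nonneg (x 1)]
  have hsA : 0 < Real.sqrt (1 - x 0 ^ 4) := Real.sqrt_pos.2 hA
  have hsB : 0 < Real.sqrt (1 - x 1 ^ 4) := Real.sqrt_pos.2 hB
  have hfac : x 0 ^ 4 - (x 0 * x 1) ^ 4 = (x 0 ^ 2) ^ 2 * (1 - x 1 ^ 4) := by ring
  have hsq : Real.sqrt ((x 0 ^ 2) ^ 2 * (1 - x 1 ^ 4)) = x 0 ^ 2 * Real.sqrt (1 - x 1 ^ 4) := by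
    rw [Real.sqrt_mul (by positivity), Real.sqrt_sq (by positivity)]
  rw [hfac, hsq, abs_of_pos h0]
  field_simp

/-- **`stub_fibration`** (signature verbatim from `Lines/hyperbola-fibration-conic.lean`, M1): the
one-coordinate substitution `z ↦ update z 1 (z 0 * z 1)` is a rule-(2) move from
`[(0,1)², 2z0²/(√(1−z0⁴)√(1−z1⁴))]` to the triangle representation. -/
theorem stub_fibration_proof :
    ∀ q : IntegralRep 2, q.domain = unitSq →
      EqOn q.integrand (fun x => 2 * x 0 ^ 2 / (Real.sqrt (1 - x 0 ^ 4) * Real.sqrt (1 - x 1 ^ 4))) unitSq →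
      ∃ T : IntegralRep 2, T.domain = {z : Fin 2 → ℝ | 0 < z 1 ∧ z 1 < z 0 ∧ z 0 < 1} ∧
        EqOn T.integrand (fun z => 2 * z 0 ^ 3 / (Real.sqrt (1 - z 0 ^ 4) * Real.sqrt (z 0 ^ 4 - z 1 ^ 4)))
          {z : Fin 2 → ℝ | 0 < z 1 ∧ z 1 < z 0 ∧ z 0 < 1} ∧
        Equivalent q T := by
  intro q hqd hqi
  have hmeas : MeasurableSet unitSq :=
    Literature.ModelTheory.ExponentialFields.IsSemialgebraic.measurableSet_holds isSemialgebraic_unitSq'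
  have hderiv : ∀ x ∈ unitSq, HasFDerivWithinAt Psi1 (L1 x) unitSq x := fun x _ =>
    (hasFDerivAt_Psi1 x).1.hasFDerivWithinAt
  -- integrability of the triangle integrand, transported from `q` along `Ψ₁`
  have hint : IntegrableOn fTri Tset := by
    rw [← image_Psi1, integrableOn_image_iff_integrableOn_abs_det_fderiv_smul volume hmeas hderiv
      injOn_Psi1]
    have hq : IntegrableOn q.integrand unitSq := hqd ▸ q.integrableOn
    refine hq.congr_fun (fun x hx => ?_) hmeas
    rw [hqi hx, (hasFDerivAt_Psi1 x).2, smul_eq_mul, mul_comm]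
    exact pullback_Psi1 x hx
  let T : IntegralRep 2 := ⟨Tset, fTri, isSemialgebraic_Tset, isSemialgebraicFunOn_fTri, hint⟩
  refine ⟨T, rfl, fun z _ => rfl, ?_⟩
  apply changeOfVariablesRel_subset_relations
  refine ⟨2, q, T, Psi1, L1, ?_, ?_, ?_, ?_, ?_, rfl⟩
  · rw [hqd]; exact isSemialgebraicMapOn_Psi1
  · rw [hqd]; exact hderiv
  · rw [hqd]; exact injOn_Psi1
  · rw [hqd]; exact image_Psi1.symm
  · intro x hx
    rw [hqd] at hx
    rw [hqi hx, (hasFDerivAt_Psi1 x).2]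
    exact pullback_Psi1 x hx

end Summit.KontsevichZagierPeriods.Grothendieck.GpcLegendreLemniscaticLine.Drefute
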